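import Mathlib
import Literature.MathematicalPhysics.StatisticalMechanics.BarlowStacking
import Summits.Ventures.Crystal3D.Theorems.StickyWulffConstantLayerChainDefs
import HarnessLib

/-!
# Plateau height for line `LayerChain` v4 (crux `StackingLiminf`, stmt-Ventures-19145), part 2′:
# Barlow cells WITH COVERING — the cells of the points of one stacking TILE space

Route `StickyWulffConstant` of the venture `Summits/Ventures/Crystal3D` (cell `crystal3d-full`).
`exists_barlowCells_covering`: the cell assignment of `…StackingLiminfBarlowCells`
(`exists_barlowCells`, p509410: measurable, volume `1/√2`, inside `B̄(p,2)`, cells of distinct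
lattice points disjoint) together with the COVERING clause: for every letter sequence `s` and every
`q ∈ ℝ³` there is a lattice point `barlowPos 1 √(2/3) s k i j` whose cell contains `q`
(`k = ⌊q₂/h⌋`, `(i, j) = ⌊A(q − P_{k,0,0})⌋` in the inverse frame `A`).  The construction is
repeated (an existential cannot be extended after the fact); the covering clause is what the LOWER
full-lattice bound of the mollified density needs (part 4, vacancy density of stub (C)).
WHAT THIS IS NOT: no stub; rung F-C1 not moved.
-/

noncomputable section

namespace Summit.Ventures.Crystal3D.Theorems.PlateauHeight

open MeasureTheory Set Metric
open Literature.MathematicalPhysics.StatisticalMechanics (barlowPos barlowStacking haggLabel)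
open Summit.Ventures.Crystal3D.LayerChain (dot3)

/-- **Barlow cells with covering.**  As `exists_barlowCells` (measurable cells of volume `1/√2`
inside `B̄(p, 2)`, pairwise disjoint over the points of a stacking), plus: the cells of the points of
`barlowStacking 1 √(2/3) s` cover `ℝ³`. -/
theorem exists_barlowCells_covering :
    ∃ Q : (Fin 3 → ℝ) → Set (Fin 3 → ℝ),
      (∀ p, MeasurableSet (Q p)) ∧
      (∀ p, volume (Q p) = ENNReal.ofReal (1 / Real.sqrt 2)) ∧
      (∀ p, ∀ q ∈ Q p, Real.sqrt (dot3 (q - p) (q - p)) ≤ 2) ∧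
      (∀ (s : ℤ → ℤ) (k i j k' i' j' : ℤ), (k, i, j) ≠ (k', i', j') →
        Disjoint (Q (WithLp.ofLp (barlowPos 1 (Real.sqrt (2 / 3)) s k i j)))
          (Q (WithLp.ofLp (barlowPos 1 (Real.sqrt (2 / 3)) s k' i' j')))) ∧
      (∀ (s : ℤ → ℤ) (q : Fin 3 → ℝ), ∃ k i j : ℤ,
        q ∈ Q (WithLp.ofLp (barlowPos 1 (Real.sqrt (2 / 3)) s k i j))) := by
  have h23 : Real.sqrt 3 * Real.sqrt (2 / 3) = Real.sqrt 2 := by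
    rw [← Real.sqrt_mul (by norm_num)]; norm_num
  set h : ℝ := Real.sqrt (2 / 3) with hh_def
  set r3 : ℝ := Real.sqrt 3 with hr3_def
  have hh : 0 < h := Real.sqrt_pos.2 (by norm_num)
  have hh2 : h ^ 2 = 2 / 3 := Real.sq_sqrt (by norm_num)
  have h3 : 0 < r3 := Real.sqrt_pos.2 (by norm_num)
  have h33 : r3 ^ 2 = 3 := Real.sq_sqrt (by norm_num)
  have hr2 : 0 < Real.sqrt 2 := Real.sqrt_pos.2 (by norm_num)
  -- the coordinate map `A d = (d₀ − d₁/√3, (2/√3) d₁, d₂/h)` and the unit box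
  set M : Matrix (Fin 3) (Fin 3) ℝ := !![1, -(1 / r3), 0; 0, 2 / r3, 0; 0, 0, 1 / h] with hM
  set A : (Fin 3 → ℝ) →ₗ[ℝ] (Fin 3 → ℝ) := Matrix.toLin' M with hA
  have hA0 : ∀ d : Fin 3 → ℝ, A d 0 = d 0 - d 1 / r3 := by
    intro d
    rw [hA, Matrix.toLin'_apply, hM]
    simp [Matrix.mulVec, dotProduct, Fin.sum_univ_three]
    ring
  have hA1 : ∀ d : Fin 3 → ℝ, A d 1 = 2 / r3 * d 1 := by
    intro d
    rw [hA, Matrix.toLin'_apply, hM]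
    simp [Matrix.mulVec, dotProduct, Fin.sum_univ_three]
  have hA2 : ∀ d : Fin 3 → ℝ, A d 2 = d 2 / h := by
    intro d
    rw [hA, Matrix.toLin'_apply, hM]
    simp [Matrix.mulVec, dotProduct, Fin.sum_univ_three]
    ring
  have hdet : LinearMap.det A = 2 / (r3 * h) := by
    rw [hA, LinearMap.det_toLin', hM, Matrix.det_fin_three]
    simp
    field_simp
  have hdet_ne : LinearMap.det A ≠ 0 := by rw [hdet]; positivity
  set box : Set (Fin 3 → ℝ) := Set.pi Set.univ (fun _ => Ico (0 : ℝ) 1) with hbox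
  have hbox_meas : MeasurableSet box := MeasurableSet.univ_pi fun _ => measurableSet_Ico
  have hbox_vol : volume box = 1 := by
    rw [hbox, volume_pi_pi]
    simp [Real.volume_Ico]
  have hAm : Measurable A := A.continuous_of_finiteDimensional.measurable
  -- coordinates of lattice points
  have hP0 : ∀ (s : ℤ → ℤ) (k i j : ℤ), WithLp.ofLp (barlowPos 1 h s k i j) 0 =
      (i : ℝ) + j / 2 + haggLabel s k / 2 := fun s k i j => by simp
  have hP1 : ∀ (s : ℤ → ℤ) (k i j : ℤ), WithLp.ofLp (barlowPos 1 h s k i j) 1 =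
      r3 / 2 * (j + haggLabel s k / 3) := fun s k i j => by simp [hr3_def]
  have hP2 : ∀ (s : ℤ → ℤ) (k i j : ℤ), WithLp.ofLp (barlowPos 1 h s k i j) 2 = k * h :=
    fun s k i j => by simp
  refine ⟨fun p => (fun q => q - p) ⁻¹' (A ⁻¹' box), fun p => ?_, fun p => ?_, fun p q hq => ?_,
    fun s k i j k' i' j' hne => ?_, fun s q => ?_⟩
  · -- measurability
    exact (hbox_meas.preimage hAm).preimage (measurable_id.sub_const p)
  · -- volume `= |det A|⁻¹ · |box| = (√3/2)·√(2/3) = 1/√2`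
    change volume ((fun q : Fin 3 → ℝ => q - p) ⁻¹' (A ⁻¹' box)) = _
    have e : (fun q : Fin 3 → ℝ => q - p) ⁻¹' (A ⁻¹' box) =
        (fun q : Fin 3 → ℝ => q + -p) ⁻¹' (A ⁻¹' box) := by
      simp [sub_eq_add_neg]
    rw [e, measure_preimage_add_right, Measure.addHaar_preimage_linearMap _ hdet_ne, hbox_vol,
      mul_one, hdet]
    congr 1
    rw [inv_div, abs_of_pos (by positivity), h23, div_eq_div_iff two_ne_zero hr2.ne']
    have : Real.sqrt 2 * Real.sqrt 2 = 2 := Real.mul_self_sqrt (by norm_num)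
    linarith
  · -- diameter: the cell lies in the Euclidean ball of radius 2 about `p`
    change q - p ∈ A ⁻¹' box at hq
    simp only [Set.mem_preimage, hbox, Set.mem_univ_pi, mem_Ico] at hq
    have h0 := hq 0
    have h1 := hq 1
    have h2 := hq 2
    rw [hA0] at h0
    rw [hA1] at h1
    rw [hA2] at h2
    set d : Fin 3 → ℝ := q - p with hd
    have hd1 : 0 ≤ d 1 ∧ d 1 < r3 / 2 := by
      constructor
      · by_contra hneg
        rw [not_le] at hneg
        have : 2 / r3 * d 1 < 0 := mul_neg_of_pos_of_neg (by positivity) hneg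
        linarith [h1.1]
      · have := h1.2
        rw [div_mul_eq_mul_div, div_lt_one h3] at this
        linarith
    have hd0 : 0 ≤ d 0 ∧ d 0 < 3 / 2 := by
      have ht : 0 ≤ d 1 / r3 ∧ d 1 / r3 < 1 / 2 := by
        constructor
        · exact div_nonneg hd1.1 h3.le
        · rw [div_lt_iff₀ h3]; linarith [hd1.2]
      constructor <;> linarith [h0.1, h0.2, ht.1, ht.2]
    have hd2 : 0 ≤ d 2 ∧ d 2 < h := by
      constructor
      · by_contra hneg
        rw [not_le] at hneg
        have : d 2 / h < 0 := div_neg_of_neg_of_pos hneg hh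
        linarith [h2.1]
      · have := h2.2
        rwa [div_lt_one hh] at this
    have hsq : dot3 d d ≤ 4 := by
      simp only [dot3]
      have e2 : d 2 * d 2 < 2 / 3 := by nlinarith [hd2.1, hd2.2, hh2]
      nlinarith [hd0.1, hd0.2, hd1.1, hd1.2, h33]
    calc Real.sqrt (dot3 d d) ≤ Real.sqrt 4 := Real.sqrt_le_sqrt hsq
      _ = 2 := by rw [show (4 : ℝ) = 2 ^ 2 by norm_num, Real.sqrt_sq (by norm_num)]
  · -- disjointness of the cells of distinct lattice points
    rw [Set.disjoint_left]
    intro q hq hq'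
    apply hne
    change q - WithLp.ofLp (barlowPos 1 h s k i j) ∈ A ⁻¹' box at hq
    change q - WithLp.ofLp (barlowPos 1 h s k' i' j') ∈ A ⁻¹' box at hq'
    simp only [Set.mem_preimage, hbox, Set.mem_univ_pi, mem_Ico] at hq hq'
    set P := WithLp.ofLp (barlowPos 1 h s k i j) with hP
    set P' := WithLp.ofLp (barlowPos 1 h s k' i' j') with hP'
    -- coordinates of `A (P' − P)`: `(Δi + ΔL/3, Δj + ΔL/3, Δk)`, each in `(−1, 1)`
    have hdiff : ∀ l : Fin 3, -1 < A (P' - P) l ∧ A (P' - P) l < 1 := by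
      intro l
      have e : A (P' - P) = A (q - P) - A (q - P') := by
        rw [← map_sub]; congr 1; abel
      rw [e, Pi.sub_apply]
      constructor <;> linarith [(hq l).1, (hq l).2, (hq' l).1, (hq' l).2]
    have c2 : A (P' - P) 2 = (k' : ℝ) - k := by
      rw [hA2, Pi.sub_apply, hP, hP', hP2, hP2, div_eq_iff hh.ne']
      ring
    have c1 : A (P' - P) 1 = ((j' : ℝ) - j) + (haggLabel s k' - haggLabel s k : ℝ) / 3 := by
      rw [hA1, Pi.sub_apply, hP, hP', hP1, hP1]
      field_simp
      ring
    have c0 : A (P' - P) 0 = ((i' : ℝ) - i) + (haggLabel s k' - haggLabel s k : ℝ) / 3 := by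
      rw [hA0, Pi.sub_apply, Pi.sub_apply, hP, hP', hP0, hP0, hP1, hP1]
      field_simp
      ring
    -- `Δk = 0`
    have hk : k = k' := by
      have hl := hdiff 2
      rw [c2] at hl
      have e1 : ((k' - k : ℤ) : ℝ) < 1 := by push_cast; exact hl.2
      have e2 : (-1 : ℝ) < ((k' - k : ℤ) : ℝ) := by push_cast; exact hl.1
      have : k' - k < 1 := by exact_mod_cast e1
      have : -1 < k' - k := by exact_mod_cast e2
      omega
    subst hk
    have hi : i = i' := by
      have hl := hdiff 0
      rw [c0] at hl
      simp only [sub_self, zero_div, add_zero] at hl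
      have e1 : ((i' - i : ℤ) : ℝ) < 1 := by push_cast; exact hl.2
      have e2 : (-1 : ℝ) < ((i' - i : ℤ) : ℝ) := by push_cast; exact hl.1
      have : i' - i < 1 := by exact_mod_cast e1
      have : -1 < i' - i := by exact_mod_cast e2
      omega
    have hj : j = j' := by
      have hl := hdiff 1
      rw [c1] at hl
      simp only [sub_self, zero_div, add_zero] at hl
      have e1 : ((j' - j : ℤ) : ℝ) < 1 := by push_cast; exact hl.2
      have e2 : (-1 : ℝ) < ((j' - j : ℤ) : ℝ) := by push_cast; exact hl.1
      have : j' - j < 1 := by exact_mod_cast e1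
      have : -1 < j' - j := by exact_mod_cast e2
      omega
    rw [hi, hj]
  · -- covering: `q` lies in the cell of the lattice point with `k = ⌊q₂/h⌋`, `(i, j) = ⌊A(q − P_k00)⌋`
    set k : ℤ := ⌊q 2 / h⌋ with hk
    set c : Fin 3 → ℝ := A (q - WithLp.ofLp (barlowPos 1 h s k 0 0)) with hc
    set i : ℤ := ⌊c 0⌋ with hi
    set j : ℤ := ⌊c 1⌋ with hj
    refine ⟨k, i, j, ?_⟩
    change q - WithLp.ofLp (barlowPos 1 h s k i j) ∈ A ⁻¹' box
    simp only [Set.mem_preimage, hbox, Set.mem_univ_pi, mem_Ico]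
    -- `A (q − P_kij) = c − (i, j, 0)`
    have e0 : A (q - WithLp.ofLp (barlowPos 1 h s k i j)) 0 = c 0 - i := by
      rw [hc, hA0, hA0, Pi.sub_apply, Pi.sub_apply, Pi.sub_apply, Pi.sub_apply, hP0, hP0, hP1, hP1]
      push_cast
      field_simp
      ring
    have e1 : A (q - WithLp.ofLp (barlowPos 1 h s k i j)) 1 = c 1 - j := by
      rw [hc, hA1, hA1, Pi.sub_apply, Pi.sub_apply, hP1, hP1]
      push_cast
      field_simp
      ring
    have e2 : A (q - WithLp.ofLp (barlowPos 1 h s k i j)) 2 = q 2 / h - k := by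
      rw [hA2, Pi.sub_apply, hP2, div_eq_iff hh.ne']
      field_simp
    intro l
    fin_cases l
    · change 0 ≤ A (q - WithLp.ofLp (barlowPos 1 h s k i j)) 0 ∧
        A (q - WithLp.ofLp (barlowPos 1 h s k i j)) 0 < 1
      rw [e0, hi]
      exact ⟨sub_nonneg.2 (Int.floor_le _), by linarith [Int.lt_floor_add_one (c 0)]⟩
    · change 0 ≤ A (q - WithLp.ofLp (barlowPos 1 h s k i j)) 1 ∧
        A (q - WithLp.ofLp (barlowPos 1 h s k i j)) 1 < 1
      rw [e1, hj]
      exact ⟨sub_nonneg.2 (Int.floor_le _), by linarith [Int.lt_floor_add_one (c 1)]⟩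
    · change 0 ≤ A (q - WithLp.ofLp (barlowPos 1 h s k i j)) 2 ∧
        A (q - WithLp.ofLp (barlowPos 1 h s k i j)) 2 < 1
      rw [e2, hk]
      exact ⟨sub_nonneg.2 (Int.floor_le _), by linarith [Int.lt_floor_add_one (q 2 / h)]⟩


end Summit.Ventures.Crystal3D.Theorems.PlateauHeight

end
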